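import Summits.CriticalPhenomena.PercolationContinuityZ3.Theses.PercNonProliferation
import Summits.CriticalPhenomena.PercolationContinuityZ3.Theorems.PercNonProliferationAssembly
import Summits.CriticalPhenomena.PercolationContinuityZ3.Theorems.PercNonProliferationSpanningPiecesCount
import Summits.CriticalPhenomena.PercolationContinuityZ3.Theorems.PercNonProliferationDensityWhp
import Summits.CriticalPhenomena.PercolationContinuityZ3.Theorems.PercShatteringRaceRaceLemma
import Literature.Probability.Percolation.HalfSpacePinnedPairs
import Literature.Probability.Percolation.PercolationProofs
import Literature.Probability.Percolation.ConnectivityProofs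
import HarnessLib

/-!
# Crux `PercNonProliferation.NonProliferation` (stmt-CriticalPhenomena-4444) — certificates of the
# load-bearing stub S1 `stub_infiniteClusterFewClasses` of line `jump-fragmentation`

Lead c8 of line `jump-fragmentation` (crux-strategist skeleton `Cruxes/NonProliferation/Lines/jump_fragmentation.lean`).
Lands with `--supports stmt-CriticalPhenomena-4444`; closes nothing by itself. No definitions: the stub

  S1 := `∃ M c>0, ∃ᶠ n, P_{p_c(ℤ³)}(no M+1 PERCOLATING points of B(n) pairwise unjoined inside B(2n)) ≥ c`

("the critical infinite cluster, if there is one, meets `B(n)` in at most `M` classes of the relation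
*joined inside the free box `B(2n)`*, with probability `≥ c`, infinitely often") is spelled out verbatim
wherever it occurs. Three certificates that fix its logical position:

* `infiniteClusterFewClasses_of_continuity` — **S ⟹ S1**: if `θ(p_c) = 0` there are a.s. no percolating
  points, so S1's event is almost sure (`M = 0`, `c = 1`). In particular S1 holds in every dimension where
  continuity is a theorem (it is NOT bitten by the barrier `SpanningClustersAboveSix`, unlike the crux).
* `infiniteClusterFewClasses_of_nonProliferation` — **crux ⟹ S1**: percolating points of `B(n)` are spanning
  representatives of `B(2n)` (an infinite open lattice path leaves `B(2n)` through `∂ⁱⁿB(2n)`), a.s.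
* `continuity_of_freeBoxSparse_of_fewClasses` — **FreeBoxSparse → S1 → θ(p_c(ℤ³)) = 0**: the route's deciding
  theorem `closes` re-glued on S1 ALONE, over the landed supports `densityWhp_proof`, the counting lemma
  `sq_card_le_mul_card_filter_of_not_exists` (with `good :=` "percolates", so no spanning hypothesis is
  needed) and the abstract assembly `nonProlifAssembly_abstract` / `nonProlifAssembly_markov`.

So, for route `PercNonProliferation`, S1 carries everything the crux was wanted for; the crux's remaining
(hyperscaling, `d = 3`-specific) content sits in the parked residue S3 of the line.
-/

noncomputable section

namespace Summit.CriticalPhenomena.PercolationContinuityZ3.Theorems.NonProliferation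

open MeasureTheory Filter Topology
open Literature.Probability.LatticeModels Literature.Probability.Percolation
open Summit.CriticalPhenomena.PercolationContinuityZ3.Theses.PercNonProliferation
open Summit.CriticalPhenomena.PercolationContinuityZ3.Theorems

/-- **S1 is a consequence of the summit** (in a continuous world there are a.s. no percolating points, so
S1's event is almost sure; `M = 0`, `c = 1`). -/
theorem infiniteClusterFewClasses_of_continuity :
    _root_.PercolationContinuityZ3 →
    ∃ (M : ℕ) (c : ℝ), 0 < c ∧ ∃ᶠ n : ℕ in atTop, c ≤ (bondPercolation (zdGraph 3) (criticalProbI 3)).real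
      {ω | ¬ ∃ x : Fin (M + 1) → Site 3, (∀ i, x i ∈ box 3 n) ∧ (∀ i, ω ∈ percolatesAt (x i)) ∧
        ∀ i j, i ≠ j → ω ∉ openConnIn (↑(box 3 (2 * n)) : Set (Site 3)) (x i) (x j)} := by
  intro h
  have h0 : theta (zdGraph 3) (0 : Site 3) (criticalProbI 3) = 0 :=
    Literature.Probability.Percolation.percolationContinuityZ3_iff.1 h
  set μ : Measure (BondConfig (Site 3)) := bondPercolation (zdGraph 3) (criticalProbI 3) with hμ
  -- every site percolates with probability `θ = 0` (translation invariance)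
  have hx0 : ∀ x : Site 3, μ.real (percolatesAt x) = 0 := by
    intro x
    have := theta_zdGraph_eq_theta_zero (d := 3) (criticalProbI 3) x
    unfold theta at this h0
    rw [hμ, this, h0]
  refine ⟨0, 1, one_pos, Frequently.of_forall fun n => ?_⟩
  -- the bad event is contained in `⋃_{x ∈ B(n)} {x percolates}`, a null set
  have hbad : μ.real {ω | ∃ x : Fin (0 + 1) → Site 3, (∀ i, x i ∈ box 3 n) ∧ (∀ i, ω ∈ percolatesAt (x i)) ∧
      ∀ i j, i ≠ j → ω ∉ openConnIn (↑(box 3 (2 * n)) : Set (Site 3)) (x i) (x j)} = 0 := by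
    refine le_antisymm ?_ measureReal_nonneg
    calc μ.real _ ≤ μ.real (⋃ x ∈ box 3 n, percolatesAt x) := by
          refine measureReal_mono ?_ (measure_ne_top _ _)
          rintro ω ⟨x, hx, hperc, -⟩
          exact Set.mem_biUnion (hx 0) (hperc 0)
      _ ≤ ∑ x ∈ box 3 n, μ.real (percolatesAt x) := measureReal_biUnion_finset_le _ _
      _ = 0 := Finset.sum_eq_zero fun x _ => hx0 x
  have hmeas : MeasurableSet {ω : BondConfig (Site 3) | ∃ x : Fin (0 + 1) → Site 3, (∀ i, x i ∈ box 3 n) ∧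
      (∀ i, ω ∈ percolatesAt (x i)) ∧
      ∀ i j, i ≠ j → ω ∉ openConnIn (↑(box 3 (2 * n)) : Set (Site 3)) (x i) (x j)} := by
    refine measurableSet_setOf.2 (Measurable.exists fun x => ?_)
    refine measurable_const.and ((Measurable.forall fun i => ?_).and
      (Measurable.forall fun i => Measurable.forall fun j => measurable_const.imp ?_))
    · exact (measurableSet_percolatesAt_holds (x i)).mem
    · exact (measurableSet_openConnIn_of_countable _ (x i) (x j)).mem.not
  have hcompl := probReal_compl_eq_one_sub (μ := μ) hmeas
  rw [hbad, sub_zero] at hcompl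
  rw [show {ω : BondConfig (Site 3) | ¬ ∃ x : Fin (0 + 1) → Site 3, (∀ i, x i ∈ box 3 n) ∧
      (∀ i, ω ∈ percolatesAt (x i)) ∧
      ∀ i j, i ≠ j → ω ∉ openConnIn (↑(box 3 (2 * n)) : Set (Site 3)) (x i) (x j)} =
    {ω : BondConfig (Site 3) | ∃ x : Fin (0 + 1) → Site 3, (∀ i, x i ∈ box 3 n) ∧
      (∀ i, ω ∈ percolatesAt (x i)) ∧
      ∀ i j, i ≠ j → ω ∉ openConnIn (↑(box 3 (2 * n)) : Set (Site 3)) (x i) (x j)}ᶜ from rfl, hcompl]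

/-- **The crux implies S1** (percolating sites of `B(n)` are spanning representatives of `B(2n)` for lattice
configurations, which are almost sure). -/
theorem infiniteClusterFewClasses_of_nonProliferation :
    Summit.CriticalPhenomena.PercolationContinuityZ3.Theses.PercNonProliferation.NonProliferation →
    ∃ (M : ℕ) (c : ℝ), 0 < c ∧ ∃ᶠ n : ℕ in atTop, c ≤ (bondPercolation (zdGraph 3) (criticalProbI 3)).real
      {ω | ¬ ∃ x : Fin (M + 1) → Site 3, (∀ i, x i ∈ box 3 n) ∧ (∀ i, ω ∈ percolatesAt (x i)) ∧
        ∀ i j, i ≠ j → ω ∉ openConnIn (↑(box 3 (2 * n)) : Set (Site 3)) (x i) (x j)} := by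
  rintro ⟨M, c, hc, hfreq⟩
  set μ : Measure (BondConfig (Site 3)) := bondPercolation (zdGraph 3) (criticalProbI 3) with hμ
  refine ⟨M, c, hc, hfreq.mono fun n hn => hn.trans ?_⟩
  -- up to the null set of non-lattice configurations, {N_n ≤ M} ⊆ S1-event
  have hae : ∀ᵐ ω ∂μ, ω ⊆ (zdGraph 3).edgeSet := ProbabilityTheory.setBernoulli_ae_subset
  refine ENNReal.toReal_mono (measure_ne_top _ _) (measure_mono_ae (hae.mono fun ω hω hωN => ?_))
  rintro ⟨x, hxbox, hperc, hbad⟩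
  exact hωN ⟨x, hxbox, fun i => exists_openConnIn_innerBoundary_of_percolatesAt
    (box_mono 3 (show n ≤ 2 * n by omega) (hxbox i)) hω (hperc i), hbad⟩

open scoped Classical in
/-- **The route decides the summit from S1 alone** (re-glued `closes` for the tenure planner):
`FreeBoxSparse → S1 → θ(p_c(ℤ³)) = 0`, over the landed supports `densityWhp_proof`, the counting lemma
`sq_card_le_mul_card_filter_of_not_exists` (with `good :=` "percolates", so no spanning hypothesis is needed)
and the abstract assembly `nonProlifAssembly_abstract` / `nonProlifAssembly_markov`. -/
theorem continuity_of_freeBoxSparse_of_fewClasses :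
    Summit.CriticalPhenomena.PercolationContinuityZ3.Theses.PercNonProliferation.FreeBoxSparse →
    (∃ (M : ℕ) (c : ℝ), 0 < c ∧ ∃ᶠ n : ℕ in atTop, c ≤ (bondPercolation (zdGraph 3) (criticalProbI 3)).real
      {ω | ¬ ∃ x : Fin (M + 1) → Site 3, (∀ i, x i ∈ box 3 n) ∧ (∀ i, ω ∈ percolatesAt (x i)) ∧
        ∀ i j, i ≠ j → ω ∉ openConnIn (↑(box 3 (2 * n)) : Set (Site 3)) (x i) (x j)}) →
    _root_.PercolationContinuityZ3 := by
  intro hSparse hS1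
  unfold FreeBoxSparse at hSparse
  refine Literature.Probability.Percolation.percolationContinuityZ3_iff.2 ?_
  by_contra hne
  have theta_nonneg : 0 ≤ theta (zdGraph 3) (0 : Site 3) (criticalProbI 3) := by
    unfold theta
    exact measureReal_nonneg
  have hθ : 0 < theta (zdGraph 3) (0 : Site 3) (criticalProbI 3) := lt_of_le_of_ne theta_nonneg (Ne.symm hne)
  obtain ⟨M, c, hc, hfreq⟩ := hS1
  have hD := densityWhp_proof (criticalProbI 3)
  have hK : ∀ n : ℕ, (0 : ℝ) < ((box 3 n).card : ℝ) := fun n =>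
    Nat.cast_pos.2 (Finset.card_pos.2 (box_nonempty 3 n))
  have hA : (bondPercolation (zdGraph 3) (criticalProbI 3)).real (Set.univ : Set (BondConfig (Site 3)))ᶜ = 0 := by
    simp
  have hVm : ∀ n : ℕ, Measurable fun ω : BondConfig (Site 3) =>
      ((((box 3 n).filter fun x => ω ∈ percolatesAt x).card : ℕ) : ℝ) := fun n =>
    nonProlifAssembly_measurable_card_filter (box 3 n) (fun x => percolatesAt x)
      (fun x => measurableSet_percolatesAt_holds x)
  have hSI : ∀ n : ℕ, Integrable (fun ω : BondConfig (Site 3) =>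
      ((((box 3 n ×ˢ box 3 n).filter fun q => ω ∈ openConnIn ↑(box 3 (2 * n)) q.1 q.2).card : ℕ) : ℝ))
        (bondPercolation (zdGraph 3) (criticalProbI 3)) ∧
      ∫ ω, ((((box 3 n ×ˢ box 3 n).filter fun q => ω ∈ openConnIn ↑(box 3 (2 * n)) q.1 q.2).card : ℕ) : ℝ)
        ∂(bondPercolation (zdGraph 3) (criticalProbI 3)) =
      ∑ q ∈ box 3 n ×ˢ box 3 n, (bondPercolation (zdGraph 3) (criticalProbI 3)).real
        (openConnIn ↑(box 3 (2 * n)) q.1 q.2) := fun n =>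
    nonProlifAssembly_integral_card_filter (bondPercolation (zdGraph 3) (criticalProbI 3)) (box 3 n ×ˢ box 3 n)
      (fun q : Site 3 × Site 3 => openConnIn (↑(box 3 (2 * n)) : Set (Site 3)) q.1 q.2)
      (fun q => measurableSet_openConnIn_of_countable _ _ _)
  have h2n : Tendsto (fun n : ℕ => 2 * n) atTop atTop :=
    tendsto_atTop_mono (fun n : ℕ => show n ≤ 2 * n by omega) tendsto_id
  have hu : Tendsto (fun n : ℕ => 64 * ((∑ x ∈ box 3 (2 * n), ∑ y ∈ box 3 (2 * n),
      (bondPercolation (zdGraph 3) (criticalProbI 3)).real (openConnIn ↑(box 3 (2 * n)) x y)) /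
        ((box 3 (2 * n)).card : ℝ) ^ 2)) atTop (𝓝 0) := by
    have h := (hSparse.comp h2n).const_mul 64
    rw [mul_zero] at h
    exact h
  have hES : ∀ n : ℕ,
      ∫ ω, ((((box 3 n ×ˢ box 3 n).filter fun q => ω ∈ openConnIn ↑(box 3 (2 * n)) q.1 q.2).card : ℕ) : ℝ)
        ∂(bondPercolation (zdGraph 3) (criticalProbI 3)) ≤
      64 * ((∑ x ∈ box 3 (2 * n), ∑ y ∈ box 3 (2 * n),
        (bondPercolation (zdGraph 3) (criticalProbI 3)).real (openConnIn ↑(box 3 (2 * n)) x y)) /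
          ((box 3 (2 * n)).card : ℝ) ^ 2) * ((box 3 n).card : ℝ) ^ 2 := by
    intro n
    rw [(hSI n).2, Finset.sum_product]
    have hT0 : 0 ≤ ∑ x ∈ box 3 (2 * n), ∑ y ∈ box 3 (2 * n),
        (bondPercolation (zdGraph 3) (criticalProbI 3)).real (openConnIn ↑(box 3 (2 * n)) x y) :=
      Finset.sum_nonneg fun x _ => Finset.sum_nonneg fun y _ => measureReal_nonneg
    have hc2 : ((box 3 (2 * n)).card : ℝ) ^ 2 ≠ 0 := (pow_pos (hK (2 * n)) 2).ne'
    calc ∑ x ∈ box 3 n, ∑ y ∈ box 3 n,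
          (bondPercolation (zdGraph 3) (criticalProbI 3)).real (openConnIn ↑(box 3 (2 * n)) x y)
        ≤ ∑ x ∈ box 3 (2 * n), ∑ y ∈ box 3 (2 * n),
          (bondPercolation (zdGraph 3) (criticalProbI 3)).real (openConnIn ↑(box 3 (2 * n)) x y) :=
          polynomialAssembly_sum_sum_mono (box_mono 3 (by omega)) fun x y => measureReal_nonneg
      _ = (∑ x ∈ box 3 (2 * n), ∑ y ∈ box 3 (2 * n),
          (bondPercolation (zdGraph 3) (criticalProbI 3)).real (openConnIn ↑(box 3 (2 * n)) x y)) /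
            ((box 3 (2 * n)).card : ℝ) ^ 2 * ((box 3 (2 * n)).card : ℝ) ^ 2 :=
          (div_mul_cancel₀ _ hc2).symm
      _ ≤ (∑ x ∈ box 3 (2 * n), ∑ y ∈ box 3 (2 * n),
          (bondPercolation (zdGraph 3) (criticalProbI 3)).real (openConnIn ↑(box 3 (2 * n)) x y)) /
            ((box 3 (2 * n)).card : ℝ) ^ 2 * (64 * ((box 3 n).card : ℝ) ^ 2) :=
          mul_le_mul_of_nonneg_left (nonProlifAssembly_card_box_two_mul_sq_le n) (div_nonneg hT0 (sq_nonneg _))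
      _ = _ := by ring
  have hS : ∀ δ : ℝ, 0 < δ → Tendsto (fun n : ℕ => (bondPercolation (zdGraph 3) (criticalProbI 3)).real
      {ω : BondConfig (Site 3) | δ * ((box 3 n).card : ℝ) ^ 2 ≤
        ((((box 3 n ×ˢ box 3 n).filter fun q => ω ∈ openConnIn ↑(box 3 (2 * n)) q.1 q.2).card : ℕ) : ℝ)})
      atTop (𝓝 0) := fun δ hδ =>
    nonProlifAssembly_markov (bondPercolation (zdGraph 3) (criticalProbI 3)) hK (fun n ω => Nat.cast_nonneg _)
      (fun n => (hSI n).1) hES hu hδ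
  refine nonProlifAssembly_abstract (bondPercolation (zdGraph 3) (criticalProbI 3)) (M := M) hθ hc hK hA hfreq
    (V := fun n ω => ((((box 3 n).filter fun x => ω ∈ percolatesAt x).card : ℕ) : ℝ)) ?_
    (fun n => measurableSet_le measurable_const (hVm n)) hD hS
  intro n ω _ hωG
  have hsub : box 3 n ⊆ box 3 (2 * n) := box_mono 3 (by omega)
  have hcount := sq_card_le_mul_card_filter_of_not_exists (box 3 n)
    ((box 3 n).filter fun x => ω ∈ percolatesAt x)
    (fun x y => ω ∈ openConnIn (↑(box 3 (2 * n)) : Set (Site 3)) x y)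
    (fun x => ω ∈ percolatesAt x) M (Finset.filter_subset _ _) ?_ ?_ ?_ ?_ hωG
  · exact_mod_cast hcount
  · intro x hx
    have hxS : x ∈ (↑(box 3 (2 * n)) : Set (Site 3)) :=
      Finset.mem_coe.2 (hsub (Finset.mem_filter.1 hx).1)
    exact ⟨hxS, hxS, SimpleGraph.Reachable.refl _⟩
  · rintro x y ⟨hx, hy, h⟩
    exact ⟨hy, hx, h.symm⟩
  · rintro x y z ⟨hx, hy, h⟩ ⟨_, hz, h'⟩
    exact ⟨hx, hz, h.trans h'⟩
  · intro x hx
    exact (Finset.mem_filter.1 hx).2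

end Summit.CriticalPhenomena.PercolationContinuityZ3.Theorems.NonProliferation

end
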